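import Summits.ResolutionOfSingularities.ResolutionOfSingularities.Theorems.EquisingularLiftEquisingularLiftOrdinaryPointsJacobianLinSubst
import Summits.ResolutionOfSingularities.ResolutionOfSingularities.Theorems.EquisingularLiftEquisingularLiftNatSubmaxLinNResidual
import Literature.AlgebraicGeometry.Motives.GeneralNonsingularForms
import HarnessLib

/-!
# The honest residual of the route decl `EquisingularLiftNat` (stmt-ResolutionOfSingularities-20038, every `n`) RE-CUT BY NAME
# (companion file `…OrdinaryPointsResidualThree`: `EquisingularLiftNatThree`, stmt-…-20148, `n = 3`): hypersurfaces whose singular points are, in some linear coordinates, ORDINARY MULTIPLE POINTS AT COORDINATE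
# VERTICES are discharged in every characteristic (next to the submaximal codimension-2 linear subspaces)

[OURS · leafhand-res-equisingularlift-7 g1, 2026-08-31; cell `pub/decomp-res`; items stmt-…-20038 / -20148] AI-produced, weaker than expert review; NOT a
statement of any manuscript; nothing here proves resolution of singularities.  DEF-FREE; no `sorry`; standard axioms; ZERO named hypotheses; pure reduction
over ✓ `SubmaxLinN.equisingularLiftNat_of_forall_elnatO_off_submaxLinN` (p823304), ✓ `SubmaxLine.equisingularLiftNatThree_of_forall_elnatO_off_submaxLine`
(p822516) and ✓ `MultiOrd.elNatAt_of_linSubst_ordinaryPoints_of_jacobian` (this generation).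

* ★ `MultiOrd.equisingularLiftNat_of_forall_elnatO_off_submaxLinN_ordinaryPoints` — `Theses.EquisingularLift.EquisingularLiftNat` holds BY NAME as soon
  as `ELNatConclusionO` is known for the non-regular integral `H ⊆ ℙⁿ_k̄` (`n ≥ 3`) cut out by prime forms `F` of degree `e ≥ 3` such that (i) `V₊(F)` has
  no codimension-2 linear subspace of multiplicity `e − 1` (lh7 g0) AND (ii) for every linear coordinate system `σ_{τ'}` and every duplicate-free marking
  `S` of coordinate vertices at which `σ_{τ'} F` has ordinary multiple points, SOME singular closed point of `V₊(σ_{τ'} F)` lies off the marked vertices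
  — i.e. the singular points of `H` are NOT «finitely many ordinary multiple points in linearly general position»;
* ★ `MultiOrd.equisingularLiftNatThree_of_forall_elnatO_off_submaxLine_ordinaryPoints` — the same re-cut of `EquisingularLiftNatThree` at `n = 3`: the
  residual of EL♮(3) is now the normal integral surfaces of degree `e ≥ 3` in `ℙ³_k̄` with no `(e−1)`-fold line and with a singular point that is NOT
  resolved by the ordinary-points family (for cubic surfaces: a non-`A₁` double point, granted the classical fact — not formalised here — that the `≤ 4`
  nodes of a nodal cubic surface are in linearly general position).

Honest reading: closes no registered stub; for `n ≥ 4` the residual still contains the summit.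
-/

set_option linter.dupNamespace false -- mandated namespace `Summit.<Summit>.<Problem>` of this single-conjunct summit

noncomputable section

open CategoryTheory CategoryTheory.Limits AlgebraicGeometry TopologicalSpace
open MvPolynomial
open Literature.AlgebraicGeometry.Resolution
open Literature.AlgebraicGeometry.Motives Literature.AlgebraicGeometry.Motives.SmoothHypersurface
open Literature.AlgebraicGeometry.Motives.ProjectiveSpace

namespace Summit.ResolutionOfSingularities.ResolutionOfSingularities.Cruxes.EquisingularLiftNat.Sections

namespace MultiOrd

/-- ★ **`Theses.EquisingularLift.EquisingularLiftNat` (stmt-…-20038) from `ELNatConclusionO` OFF the submaximal codimension-2 linear subspaces AND OFF the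
hypersurfaces whose singular points are, in some linear coordinates, ordinary multiple points at coordinate vertices** — every dimension, every
characteristic.  The new clause handed to the residual: for all mutually inverse linear substitutions `τ, τ'`, all duplicate-free `S`, if every marked vertex
chart of `σ_{τ'} F` reads `Φ_c + Ψ_c` (`Φ_c` a form of degree `μ_c ≥ 1` NONSINGULAR in the classical sense — no `z ≠ 0` with `Φ_c(z) = 0 = ∇Φ_c(z)` —, `Ψ_c ∈ (y)^{μ_c+1}`) then some `a ≠ 0` with `σ_{τ'}F(a) = 0`,
`∇σ_{τ'}F(a) = 0` is off every marked vertex; the complementary `H` are settled by ✓ `elNatAt_of_linSubst_ordinaryPoints_of_jacobian`.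
[OURS · lh7 g1 · DEF-FREE · pure reduction] [cite: Hartshorne1977, I Thm. 5.1, I Ex. 5.12] -/
theorem equisingularLiftNat_of_forall_elnatO_off_submaxLinN_ordinaryPoints
    (h : ∀ p : ℕ, p.Prime → ∀ (k : Type) [Field k] [CharP k p] [IsAlgClosed k] (n : ℕ) (H : Scheme.{0})
      (ι : H ⟶ (Literature.AlgebraicGeometry.Motives.projectiveSpace n k).left), IsClosedImmersion ι → IsIntegral H →
      (∀ y : (Literature.AlgebraicGeometry.Motives.projectiveSpace n k).left,
        ∃ U : (Literature.AlgebraicGeometry.Motives.projectiveSpace n k).left.affineOpens,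
          y ∈ (U : (Literature.AlgebraicGeometry.Motives.projectiveSpace n k).left.Opens) ∧ (ι.ker.ideal U).IsPrincipal) →
      3 ≤ n → ¬ Scheme.IsRegular H → ∀ (e : ℕ) (F : MvPolynomial (Fin (n + 1)) k), 3 ≤ e → F.IsHomogeneous e → Prime F →
      (letI := MvPolynomial.gradedAlgebra (σ := Fin (n + 1)) (R := k)
       Set.range ι = {x : Proj (homogeneousSubmodule (Fin (n + 1)) k) | F ∈ x.asHomogeneousIdeal}) →
      (∀ (τ τ' : Fin (n + 1) → MvPolynomial (Fin (n + 1)) k) (d : ℕ),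
        (∀ i, (τ i).IsHomogeneous 1) → (∀ i, (τ' i).IsHomogeneous 1) → (∀ i, aeval τ (τ' i) = X i) → (∀ i, aeval τ' (τ i) = X i) →
        (aeval τ' F).IsHomogeneous (d + 2) →
        aeval τ' F ∉ (Ideal.span {(X ⟨n - 1, by omega⟩ : MvPolynomial (Fin (n + 1)) k), X ⟨n, by omega⟩}) ^ (d + 1)) →
      (∀ (τ τ' : Fin (n + 1) → MvPolynomial (Fin (n + 1)) k) (S : List (Fin (n + 1))),
        (∀ i, (τ i).IsHomogeneous 1) → (∀ i, (τ' i).IsHomogeneous 1) → (∀ i, aeval τ (τ' i) = X i) → (∀ i, aeval τ' (τ i) = X i) →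
        S.Nodup →
        (∀ c ∈ S, ∃ (μ : ℕ) (Φ Ψ : MvPolynomial (Fin n) k), 1 ≤ μ ∧ Φ.IsHomogeneous μ ∧
          (∀ z : Fin n → k, z ≠ 0 → eval z Φ = 0 → ∃ j, eval z (pderiv j Φ) ≠ 0) ∧
          Ψ ∈ Ideal.span (Set.range (X : Fin n → MvPolynomial (Fin n) k)) ^ (μ + 1) ∧
          ProjectiveSpace.dehomogenize k c (aeval τ' F) = Φ + Ψ) →
        ∃ a : Fin (n + 1) → k, a ≠ 0 ∧ eval a (aeval τ' F) = 0 ∧ (∀ i, eval a (pderiv i (aeval τ' F)) = 0) ∧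
          ∀ c ∈ S, ∃ i, i ≠ c ∧ a i ≠ 0) →
      ELNatConclusionO k n H ι) :
    Summit.ResolutionOfSingularities.ResolutionOfSingularities.Theses.EquisingularLift.EquisingularLiftNat := by
  refine SubmaxLinN.equisingularLiftNat_of_forall_elnatO_off_submaxLinN ?_
  intro p hp k _ _ _ n H ι hι hH hloc hn hreg e F he hF hprime hrange hsubmax
  obtain ⟨r, rfl⟩ : ∃ r, n = r + 1 + 1 := ⟨n - 2, by omega⟩
  by_cases hex : ∃ (τ τ' : Fin (r + 1 + 1 + 1) → MvPolynomial (Fin (r + 1 + 1 + 1)) k) (S : List (Fin (r + 1 + 1 + 1))),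
      (∀ i, (τ i).IsHomogeneous 1) ∧ (∀ i, (τ' i).IsHomogeneous 1) ∧ (∀ i, aeval τ (τ' i) = X i) ∧ (∀ i, aeval τ' (τ i) = X i) ∧
      S.Nodup ∧
      (∀ c ∈ S, ∃ (μ : ℕ) (Φ Ψ : MvPolynomial (Fin (r + 1 + 1)) k), 1 ≤ μ ∧ Φ.IsHomogeneous μ ∧
        (∀ z : Fin (r + 1 + 1) → k, z ≠ 0 → eval z Φ = 0 → ∃ j, eval z (pderiv j Φ) ≠ 0) ∧
        Ψ ∈ Ideal.span (Set.range (X : Fin (r + 1 + 1) → MvPolynomial (Fin (r + 1 + 1)) k)) ^ (μ + 1) ∧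
        ProjectiveSpace.dehomogenize k c (aeval τ' F) = Φ + Ψ) ∧
      (∀ a : Fin (r + 1 + 1 + 1) → k, a ≠ 0 → eval a (aeval τ' F) = 0 → (∀ i, eval a (pderiv i (aeval τ' F)) = 0) →
        ∃ c ∈ S, ∀ i, i ≠ c → a i = 0)
  · obtain ⟨τ, τ', S, hτ, hτ', hinv, hinv', hS, hord, hjac⟩ := hex
    haveI := hι
    have hord' : ∀ c ∈ S, ∃ (μ : ℕ) (Φ Ψ : MvPolynomial (Fin (r + 2)) k), 1 ≤ μ ∧ Φ.IsHomogeneous μ ∧ IsNonsingularForm k Φ ∧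
        Ψ ∈ Ideal.span (Set.range (X : Fin (r + 2) → MvPolynomial (Fin (r + 2)) k)) ^ (μ + 1) ∧
        ProjectiveSpace.dehomogenize k c (aeval τ' F) = Φ + Ψ := fun c hc => by
      obtain ⟨μ, Φ, Ψ, h1, h2, h3, h4, h5⟩ := hord c hc
      exact ⟨μ, Φ, Ψ, h1, h2, isNonsingularForm_of_forall_exists_eval_pderiv_ne_zero h3, h4, h5⟩
    exact RouteCurrency.elnatO_of_elNatAt p hp k (r + 1 + 1) H ι hι hH
      (elNatAt_of_linSubst_ordinaryPoints_of_jacobian p hp ι F hF hprime hrange τ τ' hτ hτ' hinv hinv' S hS hord' hjac)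
  · refine h p hp k (r + 1 + 1) H ι hι hH hloc hn hreg e F he hF hprime hrange hsubmax fun τ τ' S hτ hτ' hinv hinv' hS hord => ?_
    by_contra hno
    refine hex ⟨τ, τ', S, hτ, hτ', hinv, hinv', hS, hord, fun a ha h0 hpart => ?_⟩
    by_contra hc
    push Not at hc
    exact hno ⟨a, ha, h0, hpart, hc⟩

end MultiOrd

end Summit.ResolutionOfSingularities.ResolutionOfSingularities.Cruxes.EquisingularLiftNat.Sections

end
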